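import Literature.Geometry.Lorentzian.ExactKerrEnd
import Literature.Geometry.Lorentzian.AFEndChartEmbedding
import Literature.Geometry.Lorentzian.KerrConvergenceProofs
import HarnessLib

/-!
# Route `ExactKerrEnds`, crux `TameEscapeToKerrEnds` (stmt-FinalStateConjecture-18522), line
# `matched-kerr-solution-map`: stub S3a `ChartKerrEnd`

Chart-level exact Kerr beyond radius `ρ` on a SOLE end is an exact Kerr end
(`InitialDataSet.HasExactKerrEnd`): take the compact exceptional set `K := (e.far ρ)ᶜ`
(`AFEnd.IsSoleEnd.isCompact_compl_far`), the open set `U := exteriorRegion ρ ⊆ ℝ³`, the chart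
`φ := e.dataChartExt ∘ (↑)` (a smooth open embedding with `Kᶜ = e.far ρ ⊆ range φ`,
`AFEndChartEmbedding`), and the given leaf `ψ` with normal `ν`; the metric and `k` clauses are
`AFEnd.hCoeff_apply_eq_dataChartExt` / `AFEnd.kCoeff_apply_eq_dataChartExt` and the chain rule
along the inclusion of the open set (`mfderiv_comp_subtypeVal'`).

The statement is the stub `ChartKerrEnd` of the registered skeleton
`Cruxes/TameEscapeToKerrEnds/Lines/matched_kerr_solution_map.lean` with its one-definition
vocabulary `IsChartExactKerrBeyond` unfolded (so that this file declares no definition).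
-/

set_option linter.dupNamespace false

noncomputable section

namespace Summit.FinalStateConjecture.FinalStateConjecture.Theorems.ExactKerrEnds

open scoped Manifold ContDiff
open Set Function TopologicalSpace Topology Literature.Geometry.Lorentzian

/-- **S3a `ChartKerrEnd` (unfolded).** On a sole asymptotically flat end `e` of `X`, if beyond
chart radius `ρ ≥ e.R` the chart components of `D` are the data induced on an injective spacelike
leaf `ψ : {ρ < ‖y‖} → Kerr.region a r₀` of the Kerr metric `g_{M,a}`, `M ≥ 0`, with future unit
normal `ν` (`hCoeff e D y (v, w) = g_{M,a}(dψ v, dψ w)`, `kCoeff e D y (v, w) = K_ν(ψ)(v, w)`),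
then `D` has an exact Kerr end: exceptional set `(e.far ρ)ᶜ`, chart `e.dataChartExt ∘ (↑)` on
`exteriorRegion ρ`, same leaf. [folklore] -/
theorem hasExactKerrEnd_of_chartExactKerrBeyond
    (X : Type) [TopologicalSpace X] [ChartedSpace E3 X] [IsManifold (𝓡 3) ∞ X] [T2Space X]
    [SecondCountableTopology X] [ConnectedSpace X] [Kerr.Facts]
    (e : AFEnd X) (D : InitialDataSet (𝓡 3) X) (ρ : ℝ) (hsole : e.IsSoleEnd) (hρ : e.R ≤ ρ)
    (hchart : ∃ (M a r₀ : ℝ) (hM : 0 ≤ M) (ψ : exteriorRegion ρ → Kerr.region a r₀)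
      (ν : NormalField 𝓘(ℝ, E4) ψ),
      Injective ψ ∧
      (Kerr.smoothMetric M a r₀).IsSpacelikeImmersion 𝓘(ℝ, E3) ψ ∧
      (Kerr.smoothMetric M a r₀).IsFutureUnitNormal 𝓘(ℝ, E3)
        ((Kerr.timeOrientation M a r₀ hM).ofLE le_top) ψ ν ∧
      (∀ (y : exteriorRegion ρ) (v w : E3),
        AFEnd.hCoeff e D (y : E3) v w =
          Kerr.bilin M a (ψ y : E4) (mfderiv 𝓘(ℝ, E3) 𝓘(ℝ, E4) ψ y v)
            (mfderiv 𝓘(ℝ, E3) 𝓘(ℝ, E4) ψ y w)) ∧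
      (∀ [(Kerr.smoothMetric M a r₀).HasLeviCivita] (y : exteriorRegion ρ) (v w : E3),
        AFEnd.kCoeff e D (y : E3) v w =
          (Kerr.smoothMetric M a r₀).secondFundamentalForm 𝓘(ℝ, E3) ψ ν y v w)) :
    D.HasExactKerrEnd := by
  obtain ⟨M, a, r₀, hM, ψ, ν, hψ, hsp, hν, hh, hk⟩ := hchart
  -- the chart of the end restricted to the open exterior region `{ρ < ‖y‖}`
  have hRval : ∀ y : exteriorRegion ρ, e.R < ‖(y : E3)‖ := fun y ↦ lt_of_le_of_lt hρ y.2
  have hemb : IsOpenEmbedding (e.dataChartExt ∘ (Subtype.val : exteriorRegion ρ → E3)) :=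
    e.isOpenEmbedding_dataChartExt_comp (exteriorRegion ρ).2.isOpenEmbedding_subtypeVal hRval
  have hsmooth : ContMDiff 𝓘(ℝ, E3) (𝓡 3) ∞
      (e.dataChartExt ∘ (Subtype.val : exteriorRegion ρ → E3)) :=
    e.contMDiff_dataChartExt_comp contMDiff_subtype_val hRval
  have hcov : e.far ρ ⊆ range (e.dataChartExt ∘ (Subtype.val : exteriorRegion ρ → E3)) :=
    e.far_subset_range_dataChartExt_comp fun z hz ↦ ⟨⟨z, hz⟩, rfl⟩
  have hderiv : ∀ y : exteriorRegion ρ,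
      mfderiv 𝓘(ℝ, E3) (𝓡 3) (e.dataChartExt ∘ (Subtype.val : exteriorRegion ρ → E3)) y =
        mfderiv 𝓘(ℝ, E3) (𝓡 3) e.dataChartExt (y : E3) := fun y ↦
    mfderiv_comp_subtypeVal' _ _
  intro _
  refine ⟨(e.far ρ)ᶜ, exteriorRegion ρ, M, a, r₀, hM,
    e.dataChartExt ∘ (Subtype.val : exteriorRegion ρ → E3), ψ, ν,
    hsole.isCompact_compl_far ρ, ?_, hemb, hsmooth, hψ, hsp, hν, fun y v w _ ↦ ?_, ?_⟩
  · rw [compl_compl]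
    exact hcov
  · have h1 := hh y v w
    rw [e.hCoeff_apply_eq_dataChartExt D (hRval y), ← hderiv y] at h1
    exact h1
  · intro _ y v w _
    have h1 := hk y v w
    rw [e.kCoeff_apply_eq_dataChartExt D (hRval y), ← hderiv y] at h1
    exact h1

/-- **Registered stub `chartKerrEnd` of crux `TameEscapeToKerrEnds` (stmt-FinalStateConjecture-18522), line
`matched-kerr-solution-map`: S3a `ChartKerrEnd` with `IsChartExactKerrBeyond` unfolded.** Chart-level exact
Kerr beyond `ρ ≥ e.R` on a sole end is an exact Kerr end. The skeleton's `stub_chartKerrEnd : ChartKerrEnd`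
is `fun X _ _ _ _ _ _ _ e D ρ hs hρ h ↦ chartKerrEnd X e D ρ hs hρ h`. [folklore] -/
theorem chartKerrEnd :
    ∀ (X : Type) [TopologicalSpace X] [ChartedSpace E3 X] [IsManifold (𝓡 3) ∞ X] [T2Space X]
      [SecondCountableTopology X] [ConnectedSpace X] [Kerr.Facts] (e : AFEnd X)
      (D : InitialDataSet (𝓡 3) X) (ρ : ℝ), e.IsSoleEnd → e.R ≤ ρ →
      (∃ (M a r₀ : ℝ) (hM : 0 ≤ M) (ψ : exteriorRegion ρ → Kerr.region a r₀)
        (ν : NormalField 𝓘(ℝ, E4) ψ),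
        Function.Injective ψ ∧
        (Kerr.smoothMetric M a r₀).IsSpacelikeImmersion 𝓘(ℝ, E3) ψ ∧
        (Kerr.smoothMetric M a r₀).IsFutureUnitNormal 𝓘(ℝ, E3)
          ((Kerr.timeOrientation M a r₀ hM).ofLE le_top) ψ ν ∧
        (∀ (y : exteriorRegion ρ) (v w : E3),
          AFEnd.hCoeff e D (y : E3) v w =
            Kerr.bilin M a (ψ y : E4) (mfderiv 𝓘(ℝ, E3) 𝓘(ℝ, E4) ψ y v)
              (mfderiv 𝓘(ℝ, E3) 𝓘(ℝ, E4) ψ y w)) ∧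
        (∀ [(Kerr.smoothMetric M a r₀).HasLeviCivita] (y : exteriorRegion ρ) (v w : E3),
          AFEnd.kCoeff e D (y : E3) v w =
            (Kerr.smoothMetric M a r₀).secondFundamentalForm 𝓘(ℝ, E3) ψ ν y v w)) →
      D.HasExactKerrEnd :=
  fun X _ _ _ _ _ _ _ e D ρ hs hρ h ↦ hasExactKerrEnd_of_chartExactKerrBeyond X e D ρ hs hρ h

end Summit.FinalStateConjecture.FinalStateConjecture.Theorems.ExactKerrEnds

end
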